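import Summits.BirchSwinnertonDyer.BirchSwinnertonDyer.Theorems.RankLeOneBSDpOfGlobalDivisibilityCertificate
import HarnessLib

/-!
# The wild rank-one row at `3` with `E[3]` IRREDUCIBLE (onto OR Cartan-normaliser image), CLASS currency:
# global divisibility (J, irreducible form) ⟹ the upper socket; JET-PRODUCT data ⟹ `BSD₃(E)` from the
# rank-zero wild leaf; UNION with STEP L (route-free; seat `bsd-wall-utd-p3` gen 1; file 7)

Files 1–3 serve the ONTO cell (`ρ̄_{E,3}` surjective: `W-ALL/2@3.O6.r1.surj`). The W-ALL leaf
`WAllExclAddWildRankOne` (`¬CM ∧ ClassO6 W 3 ∧ r_an = 1 ⟹ BSDp W 3`) also has the rows with `E[3]`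
irreducible but NOT onto (normaliser-of-Cartan images; census BLOCK-A dossier v1 §A3: 388 + 110 rank-one
classes, «untyped at r1 (u1)»). Matar–Nekovář 2019 Thm. 0.7/§0.11 needs only irreducibility, and kmc g17's
descent `bsdp_of_exactIndexManin_of_partner_bsdp` needs no image hypothesis at all, so the class theorems
of files 1–2 hold verbatim with `ρ̄₃ onto` weakened to `E[3]` irreducible + `E` non-CM:

* `bsdp_three_of_indexEqTamagawaManin_of_globalDivisibility_of_wAllExclAddWildRankZero_of_irr` — JET-PRODUCT
  sub-leaf: `ClassO6 W 3`, non-CM, `E[3]` irreducible, `r_an = 1`, ONE Heegner datum at level `N_E` with odd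
  `d_K` and `L(E^{d_K},1) ≠ 0` whose index is JET-exact; J on the frame (file 4's irreducible receptacle
  `upper_of_globalDivisibility_of_irr`) + the leaf `WAllExclAddWildRankZero` (the twist is a non-CM O6 row of
  analytic rank `0`: `classO6_twist_of_heegner`, `hasCM_iff_of_j_eq`) ⟹ `BSDp W 3`.
* `bsdp_three_of_globalDivisibility_of_stepL_of_wAllExclAddWildRankZero_of_irr` — the UNION: J + STEP L at
  slack `v₃(c)` + the leaf ⟹ `BSDp W 3`.

PARTITION currency: habitat added to files 1–3 = the irreducible-non-onto wild rank-one rows (census block A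
@3: X4-3Nn/3Ns, W type, inside the 498 normaliser r1 classes), modulo J (irreducible form), leaf #6 and —
off the JET-PRODUCT datum — STEP L. Classes closed 0; «beyond-print theorem»: NO. HONEST FRAMING: CONDITIONAL
on the displayed inputs, the named facts and the leaf (hypotheses); per datum; BSD is not proved for any
curve by this file. No definition, no named fact, no `sorry`.

References: [MatarNekovar2019] Thm. 0.7, §0.11; [Jetchev2008] Conj. 1.3, Cor. 1.5 (p. 812);
[JetchevSkinnerWan2017] §7.4.1; [GrossZagier1986] Thm. I.(6.3), V.§2; [SilvermanATAEC1994] IV.9.4.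
-/

noncomputable section

open scoped Classical

set_option linter.dupNamespace false
set_option autoImplicit false

namespace Summit.BirchSwinnertonDyer.BirchSwinnertonDyer.Theorems.SchneiderFree.Exact

open WeierstrassCurve NumberField IsDedekindDomain Field
  Literature.NumberTheory.EllipticCurves
  Literature.NumberTheory.EllipticCurves.ModularForms
  Literature.NumberTheory.EllipticCurves.Rank1Residual
  Literature.NumberTheory.EllipticCurves.Rank1Residual.Typed
  Literature.NumberTheory.EllipticCurves.KrizLi2019
  Summit.BirchSwinnertonDyer.Rank1Residual
  Summit.BirchSwinnertonDyer.Rank1Residual.Additive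
  Summit.BirchSwinnertonDyer.Rank1Residual.X11b
  Summit.BirchSwinnertonDyer.Rank1Residual.X11b.Three

/-- **UNION, irreducible image**: for `E` (globally minimal `W`) non-CM on `ClassO6 W 3` with `E[3]`
irreducible and `r_an = 1`, ONE Heegner datum at level `N_E` with odd `d_K` and `L(E^{d_K},1) ≠ 0`: J on the
frame `(Dt, H.β, ι)` to depth `ord₃ ∏_ℓ c_ℓ(E) + v₃(c)` (`hglob`, displayed) + Matar–Nekovář (named) + STEP L
at slack `v₃(c)` (`hlo`, hypothesis) + the named facts + the leaf `WAllExclAddWildRankZero` ⟹ `BSDp W 3`.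
The twist `E^{d_K}` (any globally minimal model) is a non-CM O6 row of analytic rank `0`, so the leaf pays
its `BSD₃`, and the image-free descent `bsdp_of_exactIndexManin_of_partner_bsdp` concludes.
[cite: MatarNekovar2019, Thm. 0.7 (p. 456) and §0.11 (p. 457)] [cite: JetchevSkinnerWan2017, §7.4.1 (arXiv:1512.06894 p. 30)]
[cite: GrossZagier1986, Thm. I.(6.3) and V.§2] -/
theorem bsdp_three_of_globalDivisibility_of_stepL_of_wAllExclAddWildRankZero_of_irr
    (hGZ : ∀ (N : ℕ) [NeZero N] (W : WeierstrassCurve ℚ) (K : Type) [Field K] [NumberField K],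
      gross_zagier N W K)
    (hKo : ∀ (N : ℕ) [NeZero N] (W : WeierstrassCurve ℚ) (K : Type) [Field K] [NumberField K],
      kolyvagin N W K)
    (hGZK : rank_eq_analyticRank_of_analyticRank_le_one) (hmod : hasEntireLFunction_rat)
    (hGZ73 : GrossZagier1986_thm_I_7_3)
    (hMN : MatarNekovar2019.thm07_padicValNat_card_sha_primary_add_le_of_globalDivisibility_of_irreducible)
    (hRZ : Summit.BirchSwinnertonDyer.WAllExclAddWildRankZero)
    (W : WeierstrassCurve ℚ) [W.IsElliptic] [W.IsGloballyMinimal] [NeZero (W.conductorNorm ℤ)]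
    (hCM : ¬ W.HasCM) (hO6 : ClassO6 W 3) (hirr : W.HasIrreducibleModPGaloisRep 3) (hr : W.analyticRank = 1)
    (K : Type) [Field K] [NumberField K]
    (Dt : ModularParametrizationData W (W.conductorNorm ℤ))
    (H : HeegnerDatum (W.conductorNorm ℤ) (NumberField.discr K)) (ι : K →+* ℂ)
    (P : (W.baseChange K).toAffine.Point)
    (hK : IsImaginaryQuadratic K) (hodd : Odd (NumberField.discr K))
    (hHH : SatisfiesHeegnerHypothesis (W.conductorNorm ℤ) K)
    (hLd : (W.quadraticTwist (NumberField.discr K : ℚ)).entireLFunction 1 ≠ 0)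
    (hP : WeierstrassCurve.Affine.Point.map ι.toRatAlgHom P = heegnerPointComplex Dt H)
    (hglob : ∀ (s' : ℕ), s' ≤ padicValNat 3 W.tamagawaProduct + padicValNat 3 Dt.c.natAbs →
      ∀ (n : ℕ) (d : KolyvaginHeegnerData Dt H.β ι n), Squarefree n →
        (∀ ℓ ∈ n.primeFactors, Zhang2014.IsKolyvaginPrime (W.conductorNorm ℤ) W K 3 ℓ ∧
          s' ≤ Zhang2014.kolyvaginIndex W 3 ℓ) → Koly.PDiv d 3 s')
    (hlo : IndexLowerBoundLeAt W 3 K P (padicValNat 3 Dt.c.natAbs)) :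
    BSDp W 3 := by
  have h3N : 3 ∣ W.conductorNorm ℤ :=
    (W.dvd_conductorNorm_iff_not_hasGoodReductionAtPrime 3).mpr (not_good_of_addv W 3 hO6.2.1)
  have h3w := X11b.Three.not_dvd_discr_and_not_dvd_torsionOrder_of_heegner hK hHH (by decide) h3N
  have h3 : NumberField.discr K ≠ -3 := fun h ↦ h3w.1 (h ▸ ⟨-1, by norm_num⟩)
  have h4 : NumberField.discr K ≠ -4 := by
    intro h
    rw [h] at hodd
    exact (Int.not_odd_iff_even.mpr ⟨-2, by norm_num⟩) hodd
  -- the Heegner point is non-torsion (Gross–Zagier)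
  have hL0 : W.entireLFunction 1 = 0 := entireLFunction_one_eq_zero_of_analyticRank_eq_one hr
  obtain ⟨-, hderiv⟩ := leadingLCoeff_eq_deriv_of_analyticRank_eq_one hr
  have hLK : LDerivEK W K ≠ 0 := by
    rw [lDerivEK_eq_deriv_mul W K hmod hL0]; exact mul_ne_zero hderiv hLd
  have hnt : ¬ IsOfFinAddOrder P :=
    (lDerivEK_ne_zero_iff_not_isOfFinAddOrder W (W.conductorNorm ℤ) K (hGZ _ W K) hK hHH
      ⟨Dt, H, ι, hP⟩).mp hLK
  -- the upper socket from J (irreducible receptacle)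
  have hup : Upper.IndexUpperBoundLeAt W 3 K P (padicValNat 3 Dt.c.natAbs) :=
    upper_of_globalDivisibility_of_irr hKo hMN W hCM 3 (by decide) hirr K hK h3 h4 hHH Dt H ι P hP hnt hglob
  -- the twist: a globally minimal model, a non-CM O6 row of analytic rank `0`, paid by the leaf
  have hD0 : (NumberField.discr K : ℚ) ≠ 0 := by exact_mod_cast NumberField.discr_ne_zero K
  haveI : (W.quadraticTwist (NumberField.discr K : ℚ)).IsElliptic := W.isElliptic_quadraticTwist hD0
  obtain ⟨Cd, hCd⟩ := hasGlobalMinimalModel_rat_holds (W.quadraticTwist (NumberField.discr K : ℚ))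
  haveI : (Cd • W.quadraticTwist (NumberField.discr K : ℚ)).IsGloballyMinimal := hCd
  set Wd := Cd • W.quadraticTwist (NumberField.discr K : ℚ) with hWd
  obtain ⟨hO6d, hjd⟩ := classO6_twist_of_heegner W hO6 K hK hHH hodd Wd Cd rfl
  have hCMd : ¬ Wd.HasCM := fun h ↦ hCM ((hasCM_iff_of_j_eq hjd).mp h)
  have hLd1 : Wd.entireLFunction 1 ≠ 0 := by rw [hWd, entireLFunction_smul]; exact hLd
  have hrd : Wd.analyticRank = 0 := analyticRank_eq_zero_of_entireLFunction_one_ne_zero Wd hLd1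
  have hWdB : BSDp Wd 3 := hRZ Wd hCMd hO6d hrd
  exact bsdp_of_exactIndexManin_of_partner_bsdp hGZ hKo hGZK hmod hGZ73 W 3 (W.conductorNorm ℤ) K Dt H ι P Wd
    hr rfl h3N hK hodd h3w.2 hHH hLd hP ⟨Cd, rfl⟩ (by decide) hlo hup hWdB

/-- **JET-PRODUCT sub-leaf, irreducible image**: as the union, with STEP L replaced by the JET-exactness of
the datum's index `ord₃ [E(K):ℤP] = ord₃ ∏_ℓ c_ℓ(E) + v₃(c)` (the lower socket is then idle,
`indexBounds_of_upper_of_index_le`): J + Matar–Nekovář + the named facts + the leaf `WAllExclAddWildRankZero`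
⟹ `BSDp W 3` for every non-CM `ClassO6` curve with `E[3]` irreducible and `r_an = 1` carrying such a datum.
[cite: MatarNekovar2019, Thm. 0.7 (p. 456) and §0.11 (p. 457)] [cite: Jetchev2008, Conj. 1.3 and Cor. 1.5 (p. 812)]
[cite: JetchevSkinnerWan2017, §7.4.1 (arXiv:1512.06894 p. 30)] -/
theorem bsdp_three_of_indexEqTamagawaManin_of_globalDivisibility_of_wAllExclAddWildRankZero_of_irr
    (hGZ : ∀ (N : ℕ) [NeZero N] (W : WeierstrassCurve ℚ) (K : Type) [Field K] [NumberField K],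
      gross_zagier N W K)
    (hKo : ∀ (N : ℕ) [NeZero N] (W : WeierstrassCurve ℚ) (K : Type) [Field K] [NumberField K],
      kolyvagin N W K)
    (hGZK : rank_eq_analyticRank_of_analyticRank_le_one) (hmod : hasEntireLFunction_rat)
    (hGZ73 : GrossZagier1986_thm_I_7_3)
    (hMN : MatarNekovar2019.thm07_padicValNat_card_sha_primary_add_le_of_globalDivisibility_of_irreducible)
    (hRZ : Summit.BirchSwinnertonDyer.WAllExclAddWildRankZero)
    (W : WeierstrassCurve ℚ) [W.IsElliptic] [W.IsGloballyMinimal] [NeZero (W.conductorNorm ℤ)]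
    (hCM : ¬ W.HasCM) (hO6 : ClassO6 W 3) (hirr : W.HasIrreducibleModPGaloisRep 3) (hr : W.analyticRank = 1)
    (K : Type) [Field K] [NumberField K]
    (Dt : ModularParametrizationData W (W.conductorNorm ℤ))
    (H : HeegnerDatum (W.conductorNorm ℤ) (NumberField.discr K)) (ι : K →+* ℂ)
    (P : (W.baseChange K).toAffine.Point)
    (hK : IsImaginaryQuadratic K) (hodd : Odd (NumberField.discr K))
    (hHH : SatisfiesHeegnerHypothesis (W.conductorNorm ℤ) K)
    (hLd : (W.quadraticTwist (NumberField.discr K : ℚ)).entireLFunction 1 ≠ 0)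
    (hP : WeierstrassCurve.Affine.Point.map ι.toRatAlgHom P = heegnerPointComplex Dt H)
    (hI : padicValNat 3 (AddSubgroup.zmultiples P).index =
      padicValNat 3 W.tamagawaProduct + padicValNat 3 Dt.c.natAbs)
    (hglob : ∀ (s' : ℕ), s' ≤ padicValNat 3 W.tamagawaProduct + padicValNat 3 Dt.c.natAbs →
      ∀ (n : ℕ) (d : KolyvaginHeegnerData Dt H.β ι n), Squarefree n →
        (∀ ℓ ∈ n.primeFactors, Zhang2014.IsKolyvaginPrime (W.conductorNorm ℤ) W K 3 ℓ ∧
          s' ≤ Zhang2014.kolyvaginIndex W 3 ℓ) → Koly.PDiv d 3 s') :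
    BSDp W 3 := by
  have h3N : 3 ∣ W.conductorNorm ℤ :=
    (W.dvd_conductorNorm_iff_not_hasGoodReductionAtPrime 3).mpr (not_good_of_addv W 3 hO6.2.1)
  have h3 : NumberField.discr K ≠ -3 := fun h ↦
    (X11b.Three.not_dvd_discr_and_not_dvd_torsionOrder_of_heegner hK hHH (by decide) h3N).1
      (h ▸ ⟨-1, by norm_num⟩)
  have h4 : NumberField.discr K ≠ -4 := by
    intro h
    rw [h] at hodd
    exact (Int.not_odd_iff_even.mpr ⟨-2, by norm_num⟩) hodd
  have hL0 : W.entireLFunction 1 = 0 := entireLFunction_one_eq_zero_of_analyticRank_eq_one hr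
  obtain ⟨-, hderiv⟩ := leadingLCoeff_eq_deriv_of_analyticRank_eq_one hr
  have hLK : LDerivEK W K ≠ 0 := by
    rw [lDerivEK_eq_deriv_mul W K hmod hL0]; exact mul_ne_zero hderiv hLd
  have hnt : ¬ IsOfFinAddOrder P :=
    (lDerivEK_ne_zero_iff_not_isOfFinAddOrder W (W.conductorNorm ℤ) K (hGZ _ W K) hK hHH
      ⟨Dt, H, ι, hP⟩).mp hLK
  have hup : Upper.IndexUpperBoundLeAt W 3 K P (padicValNat 3 Dt.c.natAbs) :=
    upper_of_globalDivisibility_of_irr hKo hMN W hCM 3 (by decide) hirr K hK h3 h4 hHH Dt H ι P hP hnt hglob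
  obtain ⟨-, hlo, -⟩ := indexBounds_of_upper_of_index_le hup hI.le
  exact bsdp_three_of_globalDivisibility_of_stepL_of_wAllExclAddWildRankZero_of_irr hGZ hKo hGZK hmod hGZ73
    hMN hRZ W hCM hO6 hirr hr K Dt H ι P hK hodd hHH hLd hP hglob hlo

end Summit.BirchSwinnertonDyer.BirchSwinnertonDyer.Theorems.SchneiderFree.Exact

end
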